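import Literature.AlgebraicGeometry.HodgeTheory.KunnethStandardConjectureRelativeDimension
import Literature.AlgebraicGeometry.HodgeTheory.KunnethStandardConjectureProducts
import Literature.AlgebraicGeometry.HodgeTheory.GysinProjectionNonvanishing
import Literature.AlgebraicGeometry.HodgeTheory.MotivatedClassesAlgebraic
import Literature.AlgebraicGeometry.HodgeTheory.DiagonalClassLefschetzTraceFormula
import Literature.AlgebraicGeometry.HodgeTheory.HodgeRiemannPolarizabilityProofs
import HarnessLib

/-!
# The Künneth standard conjecture passes to the factors of a product: `C(X × Y) ⟺ C(X) ∧ C(Y)`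

Family `hodge`, layer `Literature/AlgebraicGeometry/HodgeTheory`; namespace
`Literature.AlgebraicGeometry.HodgeTheory`. Theorems only (no definition, no named fact, sorry-free).

`h(X)` is a direct summand of `h(X × Y)` (Kahn, Lemma 6.30 (2): "`p^i_{M'}` is algebraic for every
direct summand `M'` of `M`"): concretely, the projection `pr_X : X ⊗ Y ⟶ X` has relative dimension
`k = dim Y`, and for an ample — or any — divisor class `η` on `Y` with `ηᵏ ≠ 0` in `H^{2k}(Y(ℂ))` the
divisor class `pr_Y^* η` on `X ⊗ Y` has `(pr_X)_*((pr_Y^* η)ᵏ) = (pr_X)_* pr_Y^*(ηᵏ) = deg(ηᵏ) · 1_X ≠ 0`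
(the fibre integral of a non-zero top class, `complexGysin_fst_map_snd_ne_zero`). So the descent of
`C` along morphisms of positive relative dimension (`KunnethStandardConjectureRelativeDimension`,
`π_X i = c⁻¹ (pr_X ⊗ pr_X)_*(L^k_{pr₂^* pr_Y^* η}(π_{X⊗Y} i))`) gives **`C(X ⊗ Y) ⟹ C(X)`**, and
symmetrically **`C(X ⊗ Y) ⟹ C(Y)`**; with the product theorem
(`kunnethComponent_diagonalClass_mem_algebraicClasses_tensor_of_forall`) this is
**`C(X ⊗ Y) ⟺ C(X) ∧ C(Y)`** for all smooth projective complex `X`, `Y` — unconditionally. A class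
`η ∈ N¹H²(Y(ℂ))` with `ηᵏ ≠ 0` always exists: the rational Kähler class of a `KaehlerRationalDatum`
(restricted Fubini–Study class), algebraic by Lefschetz `(1,1)` and with `L^k_η : H⁰ ≅ H^{2k}` by hard
Lefschetz (`exists_mem_algebraicClasses_one_lefschetzPow_one_ne_zero`).

* §1 `lefschetzPow_map_snd_one`, `lefschetzPow_map_fst_one` — `L^r_{pr^* κ} 1 = pr^*(L^r_κ 1)`;
  `exists_mem_algebraicClasses_one_lefschetzPow_one_ne_zero` — a divisor class with `η^{dim} ≠ 0`.
* §2 `kunnethComponent_diagonalClass_mem_algebraicClasses_of_tensor_left_of_ne_zero` (explicit `η`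
  on `Y`), **`…_of_tensor_left`** (`C(X ⊗ Y) ⟹ C(X)`), `…_of_tensor_right_of_ne_zero`,
  **`…_of_tensor_right`** (`C(X ⊗ Y) ⟹ C(Y)`).
* §3 **`kunnethComponents_algebraic_tensor_iff`** — `C(X ⊗ Y) ⟺ C(X) ∧ C(Y)`.

## References

* [Kahn2020] B. Kahn, Zeta and L-functions of varieties and motives, LMS LN 462, CUP 2020, §6.9
  Lemma 6.30 (2)–(3) and Theorem 6.31.
* [Kleiman1968AlgebraicCycles] S. Kleiman, Algebraic cycles and the Weil conjectures (1968), §1–§2.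
* [VoisinHodgeI2002] C. Voisin, Hodge Theory and Complex Algebraic Geometry I, CUP 2002, Thm. 6.25,
  §7.1.2.
* [FultonYoungTableaux1997] W. Fulton, Young Tableaux, CUP 1997, Appendix B §B.1 (5)–(7).
-/

noncomputable section

open CategoryTheory AlgebraicGeometry MonoidalCategory CartesianMonoidalCategory Finset
open Literature.AlgebraicTopology.SingularHomology Literature.Geometry.Kaehler
open Literature.AlgebraicGeometry.Motives (IsSmoothProjective ComplexPoints)

namespace Literature.AlgebraicGeometry.HodgeTheory

variable {l k : ℕ} {X Y : Motives.SchemeOver ℂ}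

/-! ### §1 Powers of a pulled-back divisor class; a divisor class with non-zero top power -/

/-- **`L^r_{pr_Y^* κ} 1_{X ⊗ Y} = pr_Y^*(L^r_κ 1_Y)`** (naturality of the Lefschetz iterates,
`pr_Y^* 1 = 1`). [cite: HatcherAT2002, §3.2 Prop. 3.10] [cite: VoisinHodgeI2002, §6.2.3] -/
theorem lefschetzPow_map_snd_one (κ : complexBetti Y 2) (r : ℕ) :
    lefschetzPow (complexBetti.map (snd X Y) 2 κ) r 0 (singularCohomology.one ℂ (ComplexPoints (X ⊗ Y))) =
      complexBetti.map (snd X Y) (0 + 2 * r) (lefschetzPow κ r 0 (singularCohomology.one ℂ (ComplexPoints Y))) := by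
  rw [complexBetti.map, lefschetzPow_map, singularCohomology.map_one]

/-- **`L^r_{pr_X^* κ} 1_{X ⊗ Y} = pr_X^*(L^r_κ 1_X)`**. [cite: HatcherAT2002, §3.2 Prop. 3.10]
[cite: VoisinHodgeI2002, §6.2.3] -/
theorem lefschetzPow_map_fst_one (κ : complexBetti X 2) (r : ℕ) :
    lefschetzPow (complexBetti.map (fst X Y) 2 κ) r 0 (singularCohomology.one ℂ (ComplexPoints (X ⊗ Y))) =
      complexBetti.map (fst X Y) (0 + 2 * r) (lefschetzPow κ r 0 (singularCohomology.one ℂ (ComplexPoints X))) := by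
  rw [complexBetti.map, lefschetzPow_map, singularCohomology.map_one]

/-- **Every smooth projective complex `k`-fold carries a divisor class `η ∈ N¹H²(Y(ℂ))` with `ηᵏ ≠ 0`:**
the (complexified) rational Kähler class of a `KaehlerRationalDatum` is algebraic (Lefschetz `(1,1)`,
`KaehlerRationalDatum.ofRatClass_eta_mem_algebraicClasses`) and `L^k_η : H⁰ → H^{2k}` is bijective (hard
Lefschetz, `KaehlerRationalDatum.hasHardLefschetzProperty`), while `1 ≠ 0` in `H⁰(Y(ℂ))`.
[cite: VoisinHodgeI2002, Thm. 6.25 and §7.1.2] -/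
theorem exists_mem_algebraicClasses_one_lefschetzPow_one_ne_zero (hY : IsSmoothProjective k Y) :
    ∃ η : complexBetti Y 2, η ∈ algebraicClasses Y 1 ∧
      lefschetzPow η k 0 (singularCohomology.one ℂ (ComplexPoints Y)) ≠ 0 := by
  obtain ⟨D⟩ := nonempty_kaehlerRationalDatum hY
  refine ⟨D.Hη, D.ofRatClass_eta_mem_algebraicClasses hY, fun h0 ↦ complexBetti_one_ne_zero hY ?_⟩
  exact (D.hasHardLefschetzProperty hY k 0 (by omega)).1 (h0.trans (map_zero _).symm)

/-! ### §2 `C(X ⊗ Y) ⟹ C(X)` and `C(X ⊗ Y) ⟹ C(Y)` -/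

/-- Degree-generalised fibre-integral non-vanishing `(pr_X)_* pr_Y^* ν ≠ 0` (`ν ≠ 0` of top degree
`a = 2 dim Y`). [cite: FultonYoungTableaux1997, Appendix B §B.1 (5)–(7)] -/
private theorem complexGysin_fst_map_snd_ne_zero_of_eq (hX : IsSmoothProjective l X)
    (hY : IsSmoothProjective k Y) {a : ℕ} (ha : a = 2 * k) {ν : complexBetti Y a} (hν : ν ≠ 0)
    (hdeg : a + 2 * l = 0 + 2 * (l + k)) :
    complexGysin complexOrientationFamily (Motives.IsSmoothProjective.tensor_holds hX hY) hX (fst X Y) hdeg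
      (complexBetti.map (snd X Y) a ν) ≠ 0 := by
  subst ha
  exact complexGysin_fst_map_snd_ne_zero complexOrientationFamily hX hY hν

/-- Mirror: `(pr_Y)_* pr_X^* ν ≠ 0`. [cite: FultonYoungTableaux1997, Appendix B §B.1 (5)–(7)] -/
private theorem complexGysin_snd_map_fst_ne_zero_of_eq (hX : IsSmoothProjective l X)
    (hY : IsSmoothProjective k Y) {a : ℕ} (ha : a = 2 * l) {ν : complexBetti X a} (hν : ν ≠ 0)
    (hdeg : a + 2 * k = 0 + 2 * (l + k)) :
    complexGysin complexOrientationFamily (Motives.IsSmoothProjective.tensor_holds hX hY) hY (snd X Y) hdeg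
      (complexBetti.map (fst X Y) a ν) ≠ 0 := by
  subst ha
  exact complexGysin_snd_map_fst_ne_zero complexOrientationFamily hX hY hν

/-- **`C(X ⊗ Y) ⟹ C(X)` given a divisor class `η` on `Y` with `η^{dim Y} ≠ 0`**: `pr_X : X ⊗ Y ⟶ X` has
relative dimension `k = dim Y` and `(pr_X)_*((pr_Y^* η)ᵏ) = (pr_X)_* pr_Y^*(ηᵏ) ≠ 0`, so the relative
descent `kunnethComponent_diagonalClass_mem_algebraicClasses_of_lefschetzPow_ne_zero_of_forall` applies.
[cite: Kahn2020, §6.9 Lemma 6.30 (2)] [cite: Kleiman1968AlgebraicCycles, §1–§2] -/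
theorem kunnethComponent_diagonalClass_mem_algebraicClasses_of_tensor_left_of_ne_zero
    (hX : IsSmoothProjective l X) (hY : IsSmoothProjective k Y) {η : complexBetti Y 2}
    (hη : η ∈ algebraicClasses Y 1) (hηk : lefschetzPow η k 0 (singularCohomology.one ℂ (ComplexPoints Y)) ≠ 0)
    (hCXY : ∀ (π : Fin (2 * (l + k) + 1) → complexBetti ((X ⊗ Y) ⊗ (X ⊗ Y)) (2 * (l + k))),
      (∀ i : Fin (2 * (l + k) + 1), π i ∈ kunnethPiece (X ⊗ Y) (X ⊗ Y)
        (show (2 * (l + k) - (i : ℕ)) + i = 2 * (l + k) by omega)) →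
      ∑ i, π i = diagonalClass (Motives.IsSmoothProjective.tensor_holds hX hY) →
      ∀ i, π i ∈ algebraicClasses ((X ⊗ Y) ⊗ (X ⊗ Y)) (l + k))
    {πX : Fin (2 * l + 1) → complexBetti (X ⊗ X) (2 * l)}
    (hπX : ∀ i : Fin (2 * l + 1), πX i ∈ kunnethPiece X X (show (2 * l - (i : ℕ)) + i = 2 * l by omega))
    (hΔX : ∑ i, πX i = diagonalClass hX) (i : Fin (2 * l + 1)) :
    πX i ∈ algebraicClasses (X ⊗ X) l := by
  have hXY := Motives.IsSmoothProjective.tensor_holds hX hY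
  refine kunnethComponent_diagonalClass_mem_algebraicClasses_of_lefschetzPow_ne_zero_of_forall hXY hX
    (fst X Y) (r := k) rfl (map_snd_mem_supportedClasses hX hY hη) ?_ hCXY hπX hΔX i
  rw [lefschetzPow_map_snd_one]
  exact complexGysin_fst_map_snd_ne_zero_of_eq hX hY (by omega) hηk _

/-- **`C(X ⊗ Y) ⟹ C(X)`** for all smooth projective complex `X`, `Y` (a divisor class on `Y` with
non-zero top power exists, `exists_mem_algebraicClasses_one_lefschetzPow_one_ne_zero`).
[cite: Kahn2020, §6.9 Lemma 6.30 (2)] [cite: Kleiman1968AlgebraicCycles, §1–§2] -/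
theorem kunnethComponent_diagonalClass_mem_algebraicClasses_of_tensor_left
    (hX : IsSmoothProjective l X) (hY : IsSmoothProjective k Y)
    (hCXY : ∀ (π : Fin (2 * (l + k) + 1) → complexBetti ((X ⊗ Y) ⊗ (X ⊗ Y)) (2 * (l + k))),
      (∀ i : Fin (2 * (l + k) + 1), π i ∈ kunnethPiece (X ⊗ Y) (X ⊗ Y)
        (show (2 * (l + k) - (i : ℕ)) + i = 2 * (l + k) by omega)) →
      ∑ i, π i = diagonalClass (Motives.IsSmoothProjective.tensor_holds hX hY) →
      ∀ i, π i ∈ algebraicClasses ((X ⊗ Y) ⊗ (X ⊗ Y)) (l + k))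
    {πX : Fin (2 * l + 1) → complexBetti (X ⊗ X) (2 * l)}
    (hπX : ∀ i : Fin (2 * l + 1), πX i ∈ kunnethPiece X X (show (2 * l - (i : ℕ)) + i = 2 * l by omega))
    (hΔX : ∑ i, πX i = diagonalClass hX) (i : Fin (2 * l + 1)) :
    πX i ∈ algebraicClasses (X ⊗ X) l := by
  obtain ⟨η, hη, hηk⟩ := exists_mem_algebraicClasses_one_lefschetzPow_one_ne_zero hY
  exact kunnethComponent_diagonalClass_mem_algebraicClasses_of_tensor_left_of_ne_zero hX hY hη hηk hCXY
    hπX hΔX i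

/-- **`C(X ⊗ Y) ⟹ C(Y)` given a divisor class `η` on `X` with `η^{dim X} ≠ 0`** (`pr_Y : X ⊗ Y ⟶ Y`,
relative dimension `l = dim X`, `(pr_Y)_*((pr_X^* η)ˡ) ≠ 0`).
[cite: Kahn2020, §6.9 Lemma 6.30 (2)] [cite: Kleiman1968AlgebraicCycles, §1–§2] -/
theorem kunnethComponent_diagonalClass_mem_algebraicClasses_of_tensor_right_of_ne_zero
    (hX : IsSmoothProjective l X) (hY : IsSmoothProjective k Y) {η : complexBetti X 2}
    (hη : η ∈ algebraicClasses X 1) (hηl : lefschetzPow η l 0 (singularCohomology.one ℂ (ComplexPoints X)) ≠ 0)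
    (hCXY : ∀ (π : Fin (2 * (l + k) + 1) → complexBetti ((X ⊗ Y) ⊗ (X ⊗ Y)) (2 * (l + k))),
      (∀ i : Fin (2 * (l + k) + 1), π i ∈ kunnethPiece (X ⊗ Y) (X ⊗ Y)
        (show (2 * (l + k) - (i : ℕ)) + i = 2 * (l + k) by omega)) →
      ∑ i, π i = diagonalClass (Motives.IsSmoothProjective.tensor_holds hX hY) →
      ∀ i, π i ∈ algebraicClasses ((X ⊗ Y) ⊗ (X ⊗ Y)) (l + k))
    {πY : Fin (2 * k + 1) → complexBetti (Y ⊗ Y) (2 * k)}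
    (hπY : ∀ j : Fin (2 * k + 1), πY j ∈ kunnethPiece Y Y (show (2 * k - (j : ℕ)) + j = 2 * k by omega))
    (hΔY : ∑ j, πY j = diagonalClass hY) (j : Fin (2 * k + 1)) :
    πY j ∈ algebraicClasses (Y ⊗ Y) k := by
  have hXY := Motives.IsSmoothProjective.tensor_holds hX hY
  refine kunnethComponent_diagonalClass_mem_algebraicClasses_of_lefschetzPow_ne_zero_of_forall hXY hY
    (snd X Y) (r := l) (by omega) (map_fst_mem_supportedClasses hX hY hη) ?_ hCXY hπY hΔY j
  rw [lefschetzPow_map_fst_one]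
  exact complexGysin_snd_map_fst_ne_zero_of_eq hX hY (by omega) hηl _

/-- **`C(X ⊗ Y) ⟹ C(Y)`** for all smooth projective complex `X`, `Y`.
[cite: Kahn2020, §6.9 Lemma 6.30 (2)] [cite: Kleiman1968AlgebraicCycles, §1–§2] -/
theorem kunnethComponent_diagonalClass_mem_algebraicClasses_of_tensor_right
    (hX : IsSmoothProjective l X) (hY : IsSmoothProjective k Y)
    (hCXY : ∀ (π : Fin (2 * (l + k) + 1) → complexBetti ((X ⊗ Y) ⊗ (X ⊗ Y)) (2 * (l + k))),
      (∀ i : Fin (2 * (l + k) + 1), π i ∈ kunnethPiece (X ⊗ Y) (X ⊗ Y)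
        (show (2 * (l + k) - (i : ℕ)) + i = 2 * (l + k) by omega)) →
      ∑ i, π i = diagonalClass (Motives.IsSmoothProjective.tensor_holds hX hY) →
      ∀ i, π i ∈ algebraicClasses ((X ⊗ Y) ⊗ (X ⊗ Y)) (l + k))
    {πY : Fin (2 * k + 1) → complexBetti (Y ⊗ Y) (2 * k)}
    (hπY : ∀ j : Fin (2 * k + 1), πY j ∈ kunnethPiece Y Y (show (2 * k - (j : ℕ)) + j = 2 * k by omega))
    (hΔY : ∑ j, πY j = diagonalClass hY) (j : Fin (2 * k + 1)) :
    πY j ∈ algebraicClasses (Y ⊗ Y) k := by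
  obtain ⟨η, hη, hηl⟩ := exists_mem_algebraicClasses_one_lefschetzPow_one_ne_zero hX
  exact kunnethComponent_diagonalClass_mem_algebraicClasses_of_tensor_right_of_ne_zero hX hY hη hηl hCXY
    hπY hΔY j

/-! ### §3 `C(X ⊗ Y) ⟺ C(X) ∧ C(Y)` -/

/-- **THE KÜNNETH STANDARD CONJECTURE OF A PRODUCT IS EQUIVALENT TO THAT OF ITS FACTORS:
`C(X ⊗ Y) ⟺ C(X) ∧ C(Y)`** for all smooth projective complex `X`, `Y` (family-free: "every Künneth
component of every Künneth decomposition of `cl(Δ)` is algebraic"). `⟸` is the product theorem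
`kunnethComponent_diagonalClass_mem_algebraicClasses_tensor_of_forall` (`π_{X⊗Y}` = sums of exterior
products of the `π_X`, `π_Y`); `⟹` is the descent to the factors of §2.
[cite: Kahn2020, §6.9 Lemma 6.30 (2)–(3)] [cite: Kleiman1968AlgebraicCycles, §1–§2] -/
theorem kunnethComponents_algebraic_tensor_iff (hX : IsSmoothProjective l X) (hY : IsSmoothProjective k Y) :
    (∀ (π : Fin (2 * (l + k) + 1) → complexBetti ((X ⊗ Y) ⊗ (X ⊗ Y)) (2 * (l + k))),
      (∀ i : Fin (2 * (l + k) + 1), π i ∈ kunnethPiece (X ⊗ Y) (X ⊗ Y)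
        (show (2 * (l + k) - (i : ℕ)) + i = 2 * (l + k) by omega)) →
      ∑ i, π i = diagonalClass (Motives.IsSmoothProjective.tensor_holds hX hY) →
      ∀ i, π i ∈ algebraicClasses ((X ⊗ Y) ⊗ (X ⊗ Y)) (l + k)) ↔
    (∀ (πX : Fin (2 * l + 1) → complexBetti (X ⊗ X) (2 * l)),
      (∀ i : Fin (2 * l + 1), πX i ∈ kunnethPiece X X (show (2 * l - (i : ℕ)) + i = 2 * l by omega)) →
      ∑ i, πX i = diagonalClass hX → ∀ i, πX i ∈ algebraicClasses (X ⊗ X) l) ∧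
    (∀ (πY : Fin (2 * k + 1) → complexBetti (Y ⊗ Y) (2 * k)),
      (∀ j : Fin (2 * k + 1), πY j ∈ kunnethPiece Y Y (show (2 * k - (j : ℕ)) + j = 2 * k by omega)) →
      ∑ j, πY j = diagonalClass hY → ∀ j, πY j ∈ algebraicClasses (Y ⊗ Y) k) :=
  ⟨fun h ↦ ⟨fun _ hπX hΔX ↦ kunnethComponent_diagonalClass_mem_algebraicClasses_of_tensor_left hX hY h hπX hΔX,
      fun _ hπY hΔY ↦ kunnethComponent_diagonalClass_mem_algebraicClasses_of_tensor_right hX hY h hπY hΔY⟩,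
    fun h _ hπ hΔ ↦ kunnethComponent_diagonalClass_mem_algebraicClasses_tensor_of_forall hX hY h.1 h.2 hπ hΔ⟩

end Literature.AlgebraicGeometry.HodgeTheory

end
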